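import Literature.Barriers.AnomalousDissipation.CodimensionOneRigidityFluxBound
import HarnessLib

/-!
# Additivity of the Duchon–Robert defect on test functions (assembly step, seat B)

Support file for the discharge of the named fact
`Literature.Barriers.AnomalousDissipation.DeRosaInversi2024_thm12` (`CodimensionOneRigidity.lean`).
In the last step of the proof of De Rosa–Inversi 2024, Thm. 1.2 (§4 with Prop. 2.8) the test
function is split along a smooth partition `ψ = ∑ₖ θₖ`, each piece being estimated with its own
Alberti kernel; to recombine one needs `D(∑ₖ θₖ) = ∑ₖ D(θₖ)` for the defect functional `D`, which
in the tree's vocabulary (`Torus.HasDuchonRobertDefect`: `D` is only *characterised* as the limit of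
the pairings `∫₀ᵀ∫ D_ε(u) θ`) is a statement about limits of genuine integrals. This file proves it
(`defect_sum_eq_sum_defect`) for test functions supported in time inside a slab on which `u` has a
bounded strongly measurable representative `w` (`exists_bounded_representative`): the pairings of
`u` and `w` agree (`integral_duchonRobert_congr`), `(t, x) ↦ D_ε(w(t))(x)` is jointly strongly
measurable (`stronglyMeasurable_duchonRobertApprox`, Fubini measurability of a parametric Bochner
integral) and bounded (`abs_duchonRobertApprox_le_of_bound`), so all pairings are integrals of
bounded measurable functions and additivity of the integral applies; uniqueness of limits along
`𝓝[>] 0` concludes. Also: smooth space–time functions with time support in `[a', b'] ⊂ (0, T)` are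
test functions (`isSpaceTimeTestIoo_of_support`). Everything is proved; theorems only.

## References

* L. De Rosa, M. Inversi, Comm. Math. Phys. 405 (2024), §4 and Prop. 2.8 (arXiv:2307.09189).
* J. Duchon, R. Robert, Nonlinearity 13 (2000), (9), Prop. 2.
-/

noncomputable section

namespace Literature.Barriers.AnomalousDissipation

namespace CodimensionOneRigidity

namespace Patch

open MeasureTheory TopologicalSpace Set Function Filter Topology
open scoped ENNReal NNReal RealInnerProductSpace ContDiff

open Literature.Analysis Literature.Analysis.FunctionSpaces Literature.Analysis.FluidPDE

variable {d : Type} [Fintype d]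

/-! ### Test functions with prescribed time support -/

/-- A smooth space–time function vanishing outside `[a', b']` with `0 < a'` and `b' < T` is a test
function compactly supported in `(0, T)`. [folklore] -/
theorem isSpaceTimeTestIoo_of_support {T a' b' : ℝ} {θ : ℝ → UnitAddTorus d → ℝ}
    (hθ : ContDiff ℝ ∞ (Torus.stLift θ)) (ha' : 0 < a') (hb' : b' < T)
    (hsupp : ∀ t ∉ Icc a' b', θ t = 0) : Torus.IsSpaceTimeTestIoo T θ := by
  refine ⟨⟨hθ, (b' + T) / 2, by linarith, fun t ht => hsupp t fun h => ?_⟩, a' / 2, by linarith,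
    fun t ht => hsupp t fun h => ?_⟩
  · linarith [h.2]
  · linarith [h.1]

/-- Products of a smooth space–time function with a smooth space–time function are smooth. [folklore] -/
theorem contDiff_stLift_mul {χ ψ : ℝ → UnitAddTorus d → ℝ} (hχ : ContDiff ℝ ∞ (Torus.stLift χ))
    (hψ : ContDiff ℝ ∞ (Torus.stLift ψ)) :
    ContDiff ℝ ∞ (Torus.stLift fun t x => χ t x * ψ t x) := by
  have h : (Torus.stLift fun t x => χ t x * ψ t x) = fun p => Torus.stLift χ p * Torus.stLift ψ p := by
    funext p
    rfl
  rw [h]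
  exact hχ.mul hψ

/-- Finite sums of smooth space–time functions are smooth. [folklore] -/
theorem contDiff_stLift_sum {n : ℕ} {θ : Fin n → ℝ → UnitAddTorus d → ℝ}
    (hθ : ∀ k, ContDiff ℝ ∞ (Torus.stLift (θ k))) :
    ContDiff ℝ ∞ (Torus.stLift fun t x => ∑ k, θ k t x) := by
  have h : (Torus.stLift fun t x => ∑ k, θ k t x) = fun p => ∑ k, Torus.stLift (θ k) p := by
    funext p
    simp [Torus.stLift]
  rw [h]
  exact ContDiff.sum fun k _ => hθ k

/-! ### Measurability and boundedness of the flux of a bounded measurable field -/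

section Flux

variable {w : ℝ → UnitAddTorus d → EuclideanSpace ℝ d} {Mbd : ℝ}

/-- **Joint measurability of the flux**: for a strongly measurable `w : ℝ × T^d → ℝ^d`, a mollifier
`φ` and `ε > 0`, `(t, x) ↦ D_ε(w(t))(x)` is strongly measurable (Fubini measurability of the
parametric Bochner integral in `ξ`). [folklore] -/
theorem stronglyMeasurable_duchonRobertApprox (hw : StronglyMeasurable (uncurry w))
    {φ : EuclideanSpace ℝ d → ℝ} (hφ : FluidPDE.IsMollifier φ) {ε : ℝ} (hε : 0 < ε) :
    StronglyMeasurable fun q : ℝ × UnitAddTorus d => Torus.duchonRobertApprox φ ε (w q.1) q.2 := by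
  -- the integrand on `(ℝ × T^d) × ℝ^d`
  have hinc : StronglyMeasurable fun p : (ℝ × UnitAddTorus d) × EuclideanSpace ℝ d =>
      Torus.increment (w p.1.1) p.2 p.1.2 := by
    have h1 : StronglyMeasurable fun p : (ℝ × UnitAddTorus d) × EuclideanSpace ℝ d =>
        uncurry w (p.1.1, p.1.2 + Torus.proj p.2) :=
      hw.comp_measurable ((measurable_fst.comp measurable_fst).prodMk
        ((measurable_snd.comp measurable_fst).add (Torus.measurable_proj.comp measurable_snd)))
    have h2 : StronglyMeasurable fun p : (ℝ × UnitAddTorus d) × EuclideanSpace ℝ d =>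
        uncurry w (p.1.1, p.1.2) := hw.comp_measurable measurable_fst
    exact h1.sub h2
  have hgrad : StronglyMeasurable fun p : (ℝ × UnitAddTorus d) × EuclideanSpace ℝ d =>
      gradient (FluidPDE.mollifierScale ε φ) p.2 :=
    ((Torus.continuous_gradient_mollifierScale hφ hε).comp continuous_snd).stronglyMeasurable
  have hF : StronglyMeasurable fun p : (ℝ × UnitAddTorus d) × EuclideanSpace ℝ d =>
      ⟪gradient (FluidPDE.mollifierScale ε φ) p.2, Torus.increment (w p.1.1) p.2 p.1.2⟫ *
        ‖Torus.increment (w p.1.1) p.2 p.1.2‖ ^ 2 :=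
    (hgrad.inner hinc).mul ((hinc.norm).pow 2)
  have hI : StronglyMeasurable fun q : ℝ × UnitAddTorus d => ∫ ξ,
      ⟪gradient (FluidPDE.mollifierScale ε φ) ξ, Torus.increment (w q.1) ξ q.2⟫ *
        ‖Torus.increment (w q.1) ξ q.2‖ ^ 2 :=
    hF.integral_prod_right'
  have h4 : StronglyMeasurable fun q : ℝ × UnitAddTorus d => (4⁻¹ : ℝ) * ∫ ξ,
      ⟪gradient (FluidPDE.mollifierScale ε φ) ξ, Torus.increment (w q.1) ξ q.2⟫ *
        ‖Torus.increment (w q.1) ξ q.2‖ ^ 2 :=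
    hI.const_mul _
  unfold Torus.duchonRobertApprox
  exact h4

/-- Slices of the flux are strongly measurable. [folklore] -/
theorem stronglyMeasurable_duchonRobertApprox_slice (hw : StronglyMeasurable (uncurry w))
    {φ : EuclideanSpace ℝ d → ℝ} (hφ : FluidPDE.IsMollifier φ) {ε : ℝ} (hε : 0 < ε) (t : ℝ) :
    StronglyMeasurable fun x : UnitAddTorus d => Torus.duchonRobertApprox φ ε (w t) x := by
  have h := (stronglyMeasurable_duchonRobertApprox hw hφ hε).comp_measurable
    (measurable_prodMk_left (α := ℝ) (β := UnitAddTorus d) (x := t))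
  simpa only [Function.comp_def] using h

/-- **Uniform bound of the flux of a bounded field**: if `‖w‖ ≤ Mbd` then
`|D_ε(w(t))(x)| ≤ ¼ (2 Mbd)³ ∫ ‖∇φ^ε‖`. [folklore] -/
theorem abs_duchonRobertApprox_le_of_bound (hwb : ∀ t x, ‖w t x‖ ≤ Mbd)
    {φ : EuclideanSpace ℝ d → ℝ} (hφ : FluidPDE.IsMollifier φ) {ε : ℝ} (hε : 0 < ε) (t : ℝ)
    (x : UnitAddTorus d) :
    |Torus.duchonRobertApprox φ ε (w t) x| ≤
      4⁻¹ * ((2 * Mbd) ^ 3 * ∫ ξ, ‖gradient (FluidPDE.mollifierScale ε φ) ξ‖) := by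
  have hMbd : 0 ≤ Mbd := (norm_nonneg _).trans (hwb t x)
  have hδ : ∀ ξ, ‖Torus.increment (w t) ξ x‖ ≤ 2 * Mbd := fun ξ => by
    rw [Torus.increment, two_mul]
    exact (norm_sub_le _ _).trans (add_le_add (hwb _ _) (hwb _ _))
  have hint : Integrable (fun ξ : EuclideanSpace ℝ d => ‖gradient (FluidPDE.mollifierScale ε φ) ξ‖)
      volume := by
    have h := Torus.integrable_norm_gradient_mollifierScale_mul_rpow hφ hε le_rfl
    simpa [Real.rpow_zero] using h
  rw [Torus.duchonRobertApprox, abs_mul, abs_of_pos (by norm_num : (0 : ℝ) < 4⁻¹)]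
  refine mul_le_mul_of_nonneg_left ?_ (by norm_num)
  rw [← integral_const_mul]
  refine (Real.norm_eq_abs _ ▸ norm_integral_le_of_norm_le (hint.const_mul _)
    (Eventually.of_forall fun ξ => ?_))
  calc ‖⟪gradient (FluidPDE.mollifierScale ε φ) ξ, Torus.increment (w t) ξ x⟫ *
        ‖Torus.increment (w t) ξ x‖ ^ 2‖
      = ‖⟪gradient (FluidPDE.mollifierScale ε φ) ξ, Torus.increment (w t) ξ x⟫‖ *
          ‖Torus.increment (w t) ξ x‖ ^ 2 := by
        rw [norm_mul, norm_pow, norm_norm]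
    _ ≤ ‖gradient (FluidPDE.mollifierScale ε φ) ξ‖ * ‖Torus.increment (w t) ξ x‖ *
          ‖Torus.increment (w t) ξ x‖ ^ 2 := by
        gcongr
        exact norm_inner_le_norm _ _
    _ = ‖gradient (FluidPDE.mollifierScale ε φ) ξ‖ * ‖Torus.increment (w t) ξ x‖ ^ 3 := by ring
    _ ≤ ‖gradient (FluidPDE.mollifierScale ε φ) ξ‖ * (2 * Mbd) ^ 3 := by
        gcongr
        exact hδ ξ
    _ = (2 * Mbd) ^ 3 * ‖gradient (FluidPDE.mollifierScale ε φ) ξ‖ := by ring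

/-- The pairing integrand `x ↦ D_ε(w(t))(x) θ(t, x)` is integrable on `T^d` for a continuous
space–time `θ`. [folklore] -/
theorem integrable_duchonRobertApprox_mul_slice (hw : StronglyMeasurable (uncurry w))
    (hwb : ∀ t x, ‖w t x‖ ≤ Mbd) {φ : EuclideanSpace ℝ d → ℝ} (hφ : FluidPDE.IsMollifier φ)
    {ε : ℝ} (hε : 0 < ε) {θ : ℝ → UnitAddTorus d → ℝ} (hθc : Continuous (uncurry θ)) (t : ℝ) :
    Integrable (fun x => Torus.duchonRobertApprox φ ε (w t) x * θ t x) volume := by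
  have hθt : Continuous fun x => θ t x := hθc.comp (Continuous.prodMk_right t)
  obtain ⟨C, hC⟩ := hθt.bounded_above_of_compact_support (HasCompactSupport.of_compactSpace _)
  set B : ℝ := 4⁻¹ * ((2 * Mbd) ^ 3 * ∫ ξ, ‖gradient (FluidPDE.mollifierScale ε φ) ξ‖) with hB
  refine Integrable.mono' (integrable_const (B * C))
    (((stronglyMeasurable_duchonRobertApprox_slice hw hφ hε t).mul
      hθt.stronglyMeasurable).aestronglyMeasurable) (ae_of_all _ fun x => ?_)
  rw [norm_mul]
  have h1 := abs_duchonRobertApprox_le_of_bound hwb hφ hε t x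
  rw [← Real.norm_eq_abs] at h1
  exact mul_le_mul h1 (hC x) (norm_nonneg _) ((abs_nonneg _).trans
    (abs_duchonRobertApprox_le_of_bound hwb hφ hε t x))

/-- The time integrand `t ↦ ∫ D_ε(w(t)) θ(t, ·)` of the pairing is integrable on `(0, T)` for a
continuous space–time `θ` vanishing outside a compact time interval. [folklore] -/
theorem integrable_integral_duchonRobertApprox_mul (hw : StronglyMeasurable (uncurry w))
    (hwb : ∀ t x, ‖w t x‖ ≤ Mbd) {φ : EuclideanSpace ℝ d → ℝ} (hφ : FluidPDE.IsMollifier φ)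
    {ε : ℝ} (hε : 0 < ε) {θ : ℝ → UnitAddTorus d → ℝ} (hθc : Continuous (uncurry θ))
    {a' b' : ℝ} (hsupp : ∀ t ∉ Icc a' b', θ t = 0) (T : ℝ) :
    Integrable (fun t => ∫ x, Torus.duchonRobertApprox φ ε (w t) x * θ t x)
      (volume.restrict (Ioo 0 T)) := by
  -- a uniform bound for `θ`
  have hθcs : HasCompactSupport (uncurry θ) := by
    refine HasCompactSupport.intro' (K := Icc a' b' ×ˢ (univ : Set (UnitAddTorus d)))
      (isCompact_Icc.prod isCompact_univ) (isClosed_Icc.prod isClosed_univ) fun q hq => ?_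
    have ht : q.1 ∉ Icc a' b' := fun h => hq ⟨h, mem_univ _⟩
    simp [uncurry, hsupp q.1 ht]
  obtain ⟨C, hC⟩ := hθc.bounded_above_of_compact_support hθcs
  set B : ℝ := 4⁻¹ * ((2 * Mbd) ^ 3 * ∫ ξ, ‖gradient (FluidPDE.mollifierScale ε φ) ξ‖) with hB
  -- joint measurability of the integrand, hence measurability of the time integrand
  have hjoint : StronglyMeasurable (uncurry fun t x => Torus.duchonRobertApprox φ ε (w t) x * θ t x) :=
    (stronglyMeasurable_duchonRobertApprox hw hφ hε).mul hθc.stronglyMeasurable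
  have hmeas : StronglyMeasurable fun t => ∫ x, Torus.duchonRobertApprox φ ε (w t) x * θ t x :=
    hjoint.integral_prod_right
  refine Integrable.mono' (integrable_const (B * C)) hmeas.aestronglyMeasurable
    (ae_of_all _ fun t => ?_)
  calc ‖∫ x, Torus.duchonRobertApprox φ ε (w t) x * θ t x‖
      ≤ (B * C) * (volume : Measure (UnitAddTorus d)).real univ := by
        refine norm_integral_le_of_norm_le_const (ae_of_all _ fun x => ?_)
        rw [norm_mul]
        have h1 := abs_duchonRobertApprox_le_of_bound hwb hφ hε t x
        rw [← Real.norm_eq_abs] at h1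
        exact mul_le_mul h1 (hC (t, x)) (norm_nonneg _) ((abs_nonneg _).trans
          (abs_duchonRobertApprox_le_of_bound hwb hφ hε t x))
    _ = B * C := by simp

end Flux

/-! ### Additivity of the defect -/

/-- **Additivity of the Duchon–Robert defect on test functions.** Let `D` be a Duchon–Robert
defect of `u` on `(0, T)` and `w` a bounded strongly measurable representative of `u` on
`[a, b] × T^d` (slice-wise a.e.). For finitely many test functions `θₖ` supported in time in
`[a', b'] ⊆ [a, b]` whose sum is again a test function, `D(∑ₖ θₖ) = ∑ₖ D(θₖ)`: both sides are
limits along `ε → 0⁺` of the same pairings, by additivity of the (genuine) integrals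
`∫₀ᵀ∫ D_ε(w) θₖ`. [folklore] -/
theorem defect_sum_eq_sum_defect {T : ℝ} {u w : ℝ → UnitAddTorus d → EuclideanSpace ℝ d}
    {D : Torus.STFunctional d} (hD : Torus.HasDuchonRobertDefect T u D)
    {Mbd : ℝ} (hw : StronglyMeasurable (uncurry w)) (hwb : ∀ t x, ‖w t x‖ ≤ Mbd)
    {a b a' b' : ℝ} (hsub : Icc a' b' ⊆ Icc a b)
    (huw : ∀ᵐ t ∂(volume.restrict (Icc a b)), w t =ᵐ[volume] u t)
    {n : ℕ} {θ : Fin n → ℝ → UnitAddTorus d → ℝ} (hθ : ∀ k, Torus.IsSpaceTimeTestIoo T (θ k))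
    (hθsupp : ∀ k, ∀ t ∉ Icc a' b', θ k t = 0)
    (hsum : Torus.IsSpaceTimeTestIoo T fun t x => ∑ k, θ k t x) :
    D (fun t x => ∑ k, θ k t x) = ∑ k, D (θ k) := by
  obtain ⟨ρ, hρ⟩ := FluidPDE.exists_isMollifier (d := d)
  have hθc : ∀ k, Continuous (uncurry (θ k)) := fun k =>
    Torus.continuous_uncurry_of_continuous_stLift (hθ k).1.1.continuous
  have hsumsupp : ∀ t ∉ Icc a' b', (fun t x => ∑ k, θ k t x) t = 0 := by
    intro t ht
    funext x
    simp [hθsupp _ t ht]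
  -- the two limits
  have hL := hD ρ hρ _ hsum
  have hR : Tendsto (fun ε => ∑ k, ∫ t in Ioo 0 T, ∫ x, Torus.duchonRobertApprox ρ ε (u t) x * θ k t x)
      (𝓝[>] 0) (𝓝 (∑ k, D (θ k))) :=
    tendsto_finsetSum _ fun k _ => hD ρ hρ _ (hθ k)
  refine tendsto_nhds_unique hL (hR.congr' ?_)
  filter_upwards [self_mem_nhdsWithin] with ε hε
  rw [mem_Ioi] at hε
  -- pass to the representative `w`
  rw [integral_duchonRobert_congr hsub huw hsumsupp ρ ε]
  simp_rw [integral_duchonRobert_congr hsub huw (hθsupp _) ρ ε]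
  -- additivity of the genuine integrals
  rw [← integral_finsetSum _ fun k _ =>
    integrable_integral_duchonRobertApprox_mul hw hwb hρ hε (hθc k) (hθsupp k) T]
  refine integral_congr_ae (ae_of_all _ fun t => ?_)
  dsimp only
  rw [← integral_finsetSum _ fun k _ =>
    integrable_duchonRobertApprox_mul_slice hw hwb hρ hε (hθc k) t]
  refine integral_congr_ae (ae_of_all _ fun x => ?_)
  simp [Finset.mul_sum]

end Patch

end CodimensionOneRigidity

end Literature.Barriers.AnomalousDissipation

end
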